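import Literature.MathematicalPhysics.QuantumFieldTheory.Balaban1983to89.B8Prop7GlevZd3
import Literature.MathematicalPhysics.QuantumFieldTheory.Balaban1983to89.B8LeafModelZd3P

/-!
# `Balaban1983to89.B8Prop7GlevZd3P` — [Balaban1985RegularSpaces] **Proposition 7** (Sect. G, p. 100, (1.144)–(1.145)) READ AT THE P-CARRIER
# `B8LeafModelZd3P.zdGF3P` ∕ `zdGF3HP` (the (1.145) conclusion `avgClose` now in print's p. 77 ONE-END-POINT class): the two kernel facts of n05-c g4's
# `B8Prop7GlevZd3` that the leaf's `p7` conjunct lives on, CARRIED OVER BY NAME — (K1)-P the typed sentence `B8SectGH.Prop7PrintedR fam toAxial` is STILL satisfied by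
# the junk map «forget `U₁`» (a HAZARD census, unchanged by the P-edition); (K3)-P on the members with `Ω_j = ℤᵈ` for all `j` the REPAIRED sentence
# `B8Ineq145.Prop7RepairedC (530·d)` HOLDS for the honest map `U₁ ↦ U₁^{glev}`, now in the one-end-point letter (the all-bonds bound of lit-balaban r05's admitted
# family implies every guarded letter)

statement-level skeleton of published theorems with citation tags; proofs where landed; nothing here is a claim about the Yang–Mills mass gap

T. Bałaban, *Spaces of regular gauge field configurations on a lattice and gauge fixing conditions*, Commun. Math. Phys. **99** (1985) 75–102
`[Balaban1985RegularSpaces]` ("B8"; PDF held `paper:balaban1985-cmp99-regular-spaces-gauge-fixing`), Prop. 7 (1.144)–(1.145) p. 100, (1.35) p. 82, (1.66) p. 88, p. 77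
(«we admit Ω_j = T_η»; bond convention «at least one end-point in Ω»); [3] = `[Balaban1985Averaging]` (55) p. 27, (76)–(77) pp. 29–30, (87) p. 31.

## WHY THIS FILE (cell `pub-ymgap`, HUMAN RULING D-0062 ∕ D-0149; width seat `pub-ymgap-dag-n05-w1` g0, DAG node N05 = [B8]; count-neutral)

dag-n05-d g10's P-slot knit (`Thm/BalabanUVNodesN05SubBPKnitGammaPrime`, INTENT-15, 2026-08-28) concludes `Node00.B8LeafOfRecordSubBP θ (λ.cutSubB J lan c₁)` with the Proposition-7
conjunct `p7 : B8SectGH.Prop7PrintedR (famB8OfRecordSubBP θ λ.β λ.len ·) (λ.toAxial ·.1)` DISPLAYED (`famB8OfRecordSubBP = zdGF3HP ∘ (·.1.1)`, this seat's `Node00/CarriersB8SubBP`,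
p592605).  On the old carrier n05-c g4 recorded what that conjunct is worth (`B8Prop7GlevZd3`): junk-satisfiable as typed ((K1)), honestly inhabited on print's admitted
all-`ℤᵈ` members in the repaired `C·α₂` form ((K3)).  The P-carrier (this seat's `B8LeafModelZd3P`, p588746) changed the (1.145) CONCLUSION letter `avgClose` from the box
form «`Bʲ(z) ∪ Bʲ(z+e_μ) ⊂ Ω_j`» to print's one-end-point class «`Bʲ(z) ⊂ Ω_j ∨ Bʲ(z+e_μ) ⊂ Ω_j`» — a STRONGER conclusion in general — so neither fact transfers by `rfl`.
THIS FILE records that both survive: (K1)-P because the unperturbed pair's deviation is `‖x − x‖ = 0` whatever the guard; (K3)-P because r05 g7's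
`ineq145_allLevels_admitted_explicit` (behind n05-c's `prop7_zdGF3_univ_explicit` (iii)) bounds the deviation at EVERY bond of EVERY level, which implies any guarded
letter.  `Cfg`, `Pert`, `InA`, `C140`, `InAAx` of `zdGF3P` ∕ `zdGF3HP` are `zdGF3`'s by `rfl`, so n05-c's maps `toAxialUnit` ∕ `toAxialGlev` and hypotheses are reused verbatim.

## WHAT IS PROVED (kernel, 0 sorry; theorems only)

* §1 (K1)-P `prop7PrintedR_zdGF3P_unitAxial_comp` ∕ `prop7PrintedR_zdGF3HP_unitAxial_comp` (any index map `e : J → ZdIdx d L`; the P-pin is `e := (·.1.1)`),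
  `prop7PrintedR_zdGF3P_unitAxial`.
* §2 (K3)-P `prop7RepairedC_zdGF3P_univ` ∕ `prop7RepairedC_zdGF3HP_univ` (`d ≥ 2`, `L ≥ 2`; threshold `B8Prop7AdmittedFamily.cst d L`; constant `530·d`).

## HONEST SCOPE

By-name bookkeeping over n05-c g4's `B8Prop7GlevZd3` (USED: `toAxialUnit`, `toAxialGlev`, `toAxialGlev_of_unitary`, `one_mulCfg`, `prop7_zdGF3_univ_explicit`) and, through it,
lit-balaban r05 g7's `B8Prop7AdmittedFamily`; NO estimate of [Balaban1985RegularSpaces] or [3] is proved anew or asserted.  (K1)-P is a census of the TYPED sentence (junk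
witness), not a claim about print.  LOCATED (the honest `p7` at a GENERAL nested `Ω 0 = univ` law member): on the OLD carrier it is PROVED — n05-c g6's tower-wise axial map
`B8Prop7TowerAxialIneq145.prop7RepairedC_zdGF3_toAxialTower` (p518422) ∕ record faces `B8Prop7TowerAxialRecord.prop7RepairedC_famB8OfRecordSubB(H)` (p519367) — but its
(1.145) engine `avgClose_toAxialTower` is proved bond-by-bond UNDER THE BOX GUARD (`bond_facts … hbox`: `Ū₀ʲ_b` unitary needs (1.33) on the whole two-block box `⊂ Ω_j`), so it does
NOT transfer to the P-carrier's one-end-point letter at nested members: the located open piece is (1.145) at the `j`-bonds with ONE end-block in `Ω_j^{(j)}` and the other in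
the (1.4) collar `Ω_{j−1} ∖ Ω_j` (where `U₀ ∈ 𝔄` is available at level `j − 1` only) — a collar estimate for `Ū₀ʲ_b`, not in the tree (cell bus n05-c g13 WORD-PROP7-NESTED,
2026-08-28 01:52Z, answered here).  On the all-univ members every guard is trivial, hence §2.  Print's `2α₂` below the top level is NOT claimed ((K3) gives `530d·α₂`).
Count-neutral; N05 NOT discharged; no count claim; `T_η ↦ ℤᵈ`, `G = U(𝔸)`; one finite `𝕋⁴` programme at fixed `ε`, Bałaban AS PRINTED; the Yang–Mills mass gap (Clay)
is NOT proved by any of this — R4 closes the conditional finite-`𝕋⁴` rung `BalabanLadder.UV` only; nothing continuum ∕ ℝ⁴ ∕ OS.  No `sorry`, no `def`, no `instance`,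
no `notation`.  Unit `pub-ymgap-dag-n05-w1` (g0), 2026-08-28.

[cite: Balaban1985RegularSpaces, Prop. 7 (1.144)–(1.145) p.100, (1.35) p.82, (1.66) p.88, p.77; Balaban1985Averaging, (55) p.27, (76)–(77) pp.29–30, (87) p.31]
-/

noncomputable section

open NormedSpace

namespace Literature.MathematicalPhysics.QuantumFieldTheory.Balaban1983to89.B8Prop7GlevZd3P

open B7Prop1Explicit B7Prop2Explicit
open B8Lemma1NonAbelian (mulCfg)
open B8Ineq132 (InAk)
open B8Eq119TwistedAxial (InAx inAx_self)
open B8LeafModelZd (ZdIdx)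
open B8LeafModelZd3 (zdGF3)
open B8LeafModelZd3P (zdGF3P zdGF3HP EndBlockIn)
open B8Prop7GlevZd3 (toAxialUnit toAxialGlev toAxialGlev_of_unitary one_mulCfg inAk_mono_alpha prop7_zdGF3_univ_explicit)
open B8Prop7AdmittedFamily (cst cst_pos)
open B7Eq84Concrete (glev)

-- `Site` alone could resolve to the torus sites of `Setup.lean`; re-export the `ℤ^d` sites of `B7Prop1Explicit`.
export B7Prop1Explicit (Site)

variable {d : ℕ}

/-! ## §1 (K1)-P The typed Proposition 7 on the P-carrier is still satisfied by the junk map «forget `U₁`» -/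

section Junk

variable {𝔸 : Type} [CStarAlgebra 𝔸] [Nontrivial 𝔸] {L : ℕ} {β : ℝ} {len : Site d → ℝ}

omit [Nontrivial 𝔸] in
variable (𝔸 L β len) in
/-- **(K1)-P HAZARD CENSUS — the typed Proposition 7 ON THE P-CARRIER does not bind its axial map to `U₁` either.**  For the map `toAxialUnit` («return the
unperturbed pair `(U₀, 1)`») over ANY index map `e : J → ZdIdx d L`: the (1.144)-clause is `U₀ ∈ 𝔄_k(α₀) ⊂ 𝔄_k(α₀ + 3α₂)` and `U₀ ∈ Ax_k(ℭ, U₀)` (as at `zdGF3`, the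
fields being `rfl`-equal), and the (1.145)-clause IN THE ONE-END-POINT LETTER is `‖(Ū₀ʲ)_b − (Ū₀ʲ)_b‖ = 0 ≤ 2α₂` at every guarded bond — the guard is never used.
CONSEQUENCE (census, not a claim about print): at any residual layer `λ` with `λ.toAxial := toAxialUnit ∘ …` the P-slot knit's displayed `p7` holds by this theorem;
`p7` carries content only once `toAxial` is pinned to print's map. [cite: Balaban1985RegularSpaces, Prop. 7 (1.144)–(1.145) p.100 (typed sentence, junk witness)] -/
theorem prop7PrintedR_zdGF3P_unitAxial_comp {J : Type} (e : J → ZdIdx d L) :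
    B8SectGH.Prop7PrintedR (fun j => zdGF3P 𝔸 L β len (e j)) (fun j => toAxialUnit 𝔸 L β len (e j)) := by
  refine ⟨1, one_pos, ?_⟩
  intro j α₀ α₂ _ _ hα₂ _ U₀ P hInA _
  refine ⟨⟨rfl, ?_, fun m _ => ?_⟩, fun l _ z μ _ => ?_⟩
  · show InAk L (e j).k (e j).η (α₀ + 3 * α₂) (e j).Ω (mulCfg 1 U₀.1)
    rw [one_mulCfg]
    exact inAk_mono_alpha (e j).hη (by linarith) hInA
  · show InAx L m ((e j).Λs m) U₀.1 (mulCfg 1 U₀.1)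
    rw [one_mulCfg]
    exact inAx_self L m _ U₀.1
  · show ‖((avgIter L (mulCfg 1 U₀.1) l z μ : 𝔸ˣ) : 𝔸) - ((avgIter L U₀.1 l z μ : 𝔸ˣ) : 𝔸)‖ ≤ 2 * α₂
    rw [one_mulCfg, sub_self, norm_zero]
    positivity

omit [Nontrivial 𝔸] in
variable (𝔸 L β len) in
/-- (K1)-P on the P-carrier with Theorem 8's source space as printed (`zdGF3HP`; the P-pin's family is `e := (·.1.1)`): same junk witness, same proof (the Prop-7 letters of
`zdGF3HP` are `zdGF3P`'s by `rfl`). [cite: Balaban1985RegularSpaces, Prop. 7 (1.144)–(1.145) p.100 (typed sentence, junk witness)] -/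
theorem prop7PrintedR_zdGF3HP_unitAxial_comp {J : Type} (e : J → ZdIdx d L) :
    B8SectGH.Prop7PrintedR (fun j => zdGF3HP 𝔸 L β len (e j)) (fun j => toAxialUnit 𝔸 L β len (e j)) :=
  prop7PrintedR_zdGF3P_unitAxial_comp 𝔸 L β len e

omit [Nontrivial 𝔸] in
variable (𝔸 L β len) in
/-- (K1)-P on the full carrier index (`e := id`). [cite: Balaban1985RegularSpaces, Prop. 7 (1.144)–(1.145) p.100 (typed sentence, junk witness)] -/
theorem prop7PrintedR_zdGF3P_unitAxial :
    B8SectGH.Prop7PrintedR (fun i : ZdIdx d L => zdGF3P 𝔸 L β len i) (toAxialUnit 𝔸 L β len) :=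
  prop7PrintedR_zdGF3P_unitAxial_comp 𝔸 L β len id

end Junk

/-! ## §2 (K3)-P The members with `Ω_j = ℤᵈ` at every level: the REPAIRED Proposition 7 in the one-end-point letter, by n05-c's (K3) -/

section Univ

variable {𝔸 : Type} [CStarAlgebra 𝔸] [Nontrivial 𝔸] {L : ℕ} {β : ℝ} {len : Site d → ℝ}

variable (𝔸 β len) in
/-- **(K3)-P THE REPAIRED PROPOSITION 7 HOLDS AT THE P-CARRIER ON THE MEMBERS WITH `Ω_j = ℤᵈ` FOR ALL `j`**, for the honest map `toAxialGlev`, in the P-carrier's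
ONE-END-POINT (1.145) letter, with constant `530·d`: `B8Ineq145.Prop7RepairedC (530·d) (zdGF3P … ∘ Subtype.val) (toAxialGlev …)` over `{i : ZdIdx d L // ∀ j, i.Ω j = univ}`
(threshold `c(d, L) = B8Prop7AdmittedFamily.cst d L`; `d ≥ 2`, `L ≥ 2`).  From n05-c's `prop7_zdGF3_univ_explicit` — (i) `glev` unitary, (ii) (1.144) in `InAAx` (a `zdGF3` field,
`rfl`-equal), (iii) (1.145) at EVERY bond of EVERY level `j ≤ k` with `530d·α₂` — the one-end-point guard being simply discarded.  Print's `2α₂` below the top level is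
NOT claimed. [cite: Balaban1985RegularSpaces, Prop. 7 (1.144)–(1.145) p.100, (1.35) p.82, p.77 («we admit Ω_j = T_η»)] -/
theorem prop7RepairedC_zdGF3P_univ (hd2 : 2 ≤ d) (hL : 2 ≤ L) :
    B8Ineq145.Prop7RepairedC (530 * (d : ℝ))
      (fun i : {i : ZdIdx d L // ∀ j, i.Ω j = Set.univ} => zdGF3P 𝔸 L β len i.1)
      (fun i => toAxialGlev 𝔸 L β len (le_trans one_le_two hL) i.1) := by
  have hd : 1 ≤ d := le_trans one_le_two hd2
  have hL1 : 1 ≤ L := le_trans one_le_two hL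
  refine ⟨cst d L, cst_pos hd L hL1, ?_⟩
  intro i α₀ α₂ hα₀ hα₀c hα₂ hα₂c U₀ P hInA h140
  obtain ⟨hu1, hAAx, hall, -⟩ := prop7_zdGF3_univ_explicit hd2 hL i.1 i.2 hα₀ hα₀c hα₂ hα₂c U₀ P hInA h140
  refine ⟨hAAx, ?_⟩
  show (zdGF3P 𝔸 L β len i.1).avgClose (530 * (d : ℝ) * α₂) U₀ (toAxialGlev 𝔸 L β len hL1 i.1 U₀ P)
  rw [toAxialGlev_of_unitary hL1 i.1 U₀ P hu1]
  intro j hj z μ _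
  exact hall j hj z μ

variable (𝔸 β len) in
/-- (K3)-P on the P-carrier with Theorem 8's source space as printed (`zdGF3HP`): the Prop-7 letters are `zdGF3P`'s by `rfl`.
[cite: Balaban1985RegularSpaces, Prop. 7 (1.144)–(1.145) p.100, p.77 («we admit Ω_j = T_η»)] -/
theorem prop7RepairedC_zdGF3HP_univ (hd2 : 2 ≤ d) (hL : 2 ≤ L) :
    B8Ineq145.Prop7RepairedC (530 * (d : ℝ))
      (fun i : {i : ZdIdx d L // ∀ j, i.Ω j = Set.univ} => zdGF3HP 𝔸 L β len i.1)
      (fun i => toAxialGlev 𝔸 L β len (le_trans one_le_two hL) i.1) :=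
  prop7RepairedC_zdGF3P_univ 𝔸 β len hd2 hL

end Univ

#print axioms prop7PrintedR_zdGF3P_unitAxial
#print axioms prop7RepairedC_zdGF3P_univ

end Literature.MathematicalPhysics.QuantumFieldTheory.Balaban1983to89.B8Prop7GlevZd3P

end
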